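import Literature.MathematicalPhysics.QuantumFieldTheory.Balaban1983to89.B8Eq146AExpansion

/-!
# `T4Continuum.ShellMeasureCubicTaylor` — THIRD-ORDER TAYLOR DATA in a Banach algebra and the explicit polynomials of a
# word of exponentials to the third order (file 1 of 3 of «S65 f4»: the BCH-free route to [Balaban1985Variational] (39))

Cell `pub-balaban`, sub-cell `t4`, spine estimate NE7c (node U5b), NE7c ROUND-2 crew `t4-ne7c-formalise-*`, unit
`b2b-balaban-t4-ne7c-formalise-leaf-03` gen 4; OFFER «S65 f4» (journal `CLAIMS.log` «OFFER + INTENT — NE7c-S65 f4»), file 1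
of 3 (file 2 `ShellMeasureCubicWord`: the cubic word algebra under a cyclic functional; file 3
`ShellMeasurePlaquetteCubicSplit`: the (39)∕(40) split of the one-grid Wilson plaquette pair of the owner's S62 f2
`ShellMeasureWilsonGradientTail`).  ADDITIVE: imports b08's `B8Eq146AExpansion` ONLY (for its second-order Taylor data
`T2`, the real remainders `expRem`∕`expRem3` and `exp_le_taylor4`); modifies nothing; [folklore] elementary normed-algebra
bookkeeping; 0 `def … : Prop` (the one `structure … : Prop`, `T3`, is a generic Taylor-data predicate on four elements
of a Banach algebra and a real amplitude, exactly as b08's `T2` — it names no object of the series), 0 sorry, 0 citation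
tags.

HONEST FRAMING.  Finite four-torus programme, rung (B)+1 only — NOT infinite volume, NOT a mass gap, NOT the Clay
problem, NOT summit progress.  NE7c (`T4IndicatorShell.ShellWeightBound`) is NOT PRINTED and NOT PROVED; «NE7c ⇐ the
named binders».  Nothing of [Balaban1985Variational] is asserted.  HONEST DEPENDENCY (cell, verbatim): continuum YM on
T⁴ ⇐ BetaPertH ∧ nine spine estimates (0/9 proved); BetaPertH ⇐ (D1) ∧ (D4) ∧ CAP+tail; G-an2-4 gates asym, D1 and
NE2/3/4.

WHAT IS PROVED.
* §0 `expRem4 t = e^t − 1 − t − t²/2 − t³/6`, its product rule `expRem4_add`, monotonicity, and `expRem4 t ≤ (5/96)t⁴`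
  on `[0, 1]`.
* §1 THIRD-ORDER TAYLOR DATA `T3 P L Q C s`: `P = 1 + L + Q + C + (fourth order)` with amplitude `s`, every order
  controlled EXACTLY by the real exponential series (`‖L‖ ≤ s`, `‖Q‖ ≤ s²/2`, `‖C‖ ≤ s³/6`, `‖P − 1‖ ≤ e^s − 1`,
  `‖P − 1 − L‖ ≤ ρ(s)`, `‖P − 1 − L − Q‖ ≤ ρ₃(s)`, `‖P − 1 − L − Q − C‖ ≤ ρ₄(s)`); closed under PRODUCTS with the
  cubic term `C₁ + Q₁L₂ + L₁Q₂ + C₂` and amplitude `s₁ + s₂` (`T3.mul`, through the identity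
  `P₁P₂ − 1 − L − Q − C = (P₁−1−L₁−Q₁−C₁) + (P₂−1−L₂−Q₂−C₂) + (P₁−1−L₁−Q₁)L₂ + (P₁−1−L₁)(P₂−1−L₂) + L₁(P₂−1−L₂−Q₂)`
  and `ρ₄(s₁ + s₂) = ρ₄(s₁) + ρ₄(s₂) + ρ₃(s₁)s₂ + ρ(s₁)ρ(s₂) + s₁ρ₃(s₂)`), and `T3.exp`: `e^B` with `L = B`, `Q = ½B²`,
  `C = ⅙B³`.
* §2 Words: `expProd ys = e^{y₁}⋯e^{yₙ}` carries `T3` data with the explicit nested polynomials `polyL`∕`polyQ`∕`polyC`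
  (`polyC (y :: ys) = ⅙y³ + ½y²·polyL ys + y·polyQ ys + polyC ys`) and amplitude `Σ‖yᵢ‖` (`t3_expProd`); homogeneity
  `polyL (t•ys) = t•polyL ys`, `polyQ (t•ys) = t²•polyQ ys`, `polyC (t•ys) = t³•polyC ys`.
-/

noncomputable section

open scoped BigOperators
open NormedSpace

namespace Summit.QuantumFields.BalabanUV.T4Continuum.ShellMeasureCubicTaylor

open Literature.MathematicalPhysics.QuantumFieldTheory.Balaban1983to89
open B7Prop1Explicit (expRem expRem_nonneg expRem_mono expRem_add norm_exp_sub_one_le_of_norm_le)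
open B8Eq146AExpansion (expRem3 expRem3_nonneg expRem3_add expRem3_mono exp_sub_one_mono exp_le_taylor4 T2)

/-! ## §0 The fourth-order real remainder `ρ₄(t) = e^t − 1 − t − t²/2 − t³/6` -/

section RealTaylor

/-- `ρ₄(t) = e^t − 1 − t − t²/2 − t³/6`. [folklore] -/
def expRem4 (t : ℝ) : ℝ := Real.exp t - 1 - t - t ^ 2 / 2 - t ^ 3 / 6

/-- `ρ₄ ≥ 0` on `[0, ∞)`. [folklore] -/
theorem expRem4_nonneg {t : ℝ} (ht : 0 ≤ t) : 0 ≤ expRem4 t := by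
  have h := Real.sum_le_exp_of_nonneg ht 4
  simp only [Finset.sum_range_succ, Finset.sum_range_zero, Nat.factorial] at h
  unfold expRem4
  norm_num at h
  linarith

/-- The multiplicative bookkeeping of fourth-order remainders:
`ρ₄(a + b) = ρ₄(a) + ρ₄(b) + ρ₃(a)·b + ρ(a)·ρ(b) + a·ρ₃(b)`. [folklore] -/
theorem expRem4_add (a b : ℝ) :
    expRem4 (a + b) = expRem4 a + expRem4 b + expRem3 a * b + expRem a * expRem b + a * expRem3 b := by
  unfold expRem4 expRem3 expRem
  rw [Real.exp_add]
  ring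

/-- `ρ₄` is monotone on `[0, ∞)`. [folklore] -/
theorem expRem4_mono {s t : ℝ} (hs : 0 ≤ s) (hst : s ≤ t) : expRem4 s ≤ expRem4 t := by
  have h := expRem4_add s (t - s)
  rw [add_sub_cancel] at h
  have h1 := expRem4_nonneg (sub_nonneg.mpr hst)
  have h2 := expRem3_nonneg hs
  have h3 := expRem_nonneg s
  have h4 := expRem_nonneg (t - s)
  have h5 := expRem3_nonneg (sub_nonneg.mpr hst)
  nlinarith

/-- `ρ₄(t) ≤ (5/96)t⁴` on `[0, 1]` (Mathlib `Real.exp_bound'`, `n = 4`, through b08's `exp_le_taylor4`). [folklore] -/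
theorem expRem4_le {t : ℝ} (h0 : 0 ≤ t) (h1 : t ≤ 1) : expRem4 t ≤ 5 / 96 * t ^ 4 := by
  have := exp_le_taylor4 h0 h1
  unfold expRem4
  linarith

end RealTaylor

/-! ## §1 Third-order Taylor data in a Banach algebra -/

section Taylor

variable {𝔸 : Type*} [NormedRing 𝔸] [NormedAlgebra ℂ 𝔸] [CompleteSpace 𝔸]

/-- THIRD-ORDER TAYLOR DATA: `P = 1 + L + Q + C + (fourth order)` with amplitude `s`; every order is controlled by the
real exponential series at `s`. [folklore] -/
structure T3 (P L Q C : 𝔸) (s : ℝ) : Prop where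
  norm_lin : ‖L‖ ≤ s
  norm_quad : ‖Q‖ ≤ s ^ 2 / 2
  norm_cub : ‖C‖ ≤ s ^ 3 / 6
  ord0 : ‖P - 1‖ ≤ Real.exp s - 1
  ord1 : ‖P - 1 - L‖ ≤ expRem s
  ord2 : ‖P - 1 - L - Q‖ ≤ expRem3 s
  ord3 : ‖P - 1 - L - Q - C‖ ≤ expRem4 s

namespace T3

variable {P P₁ P₂ L L' L₁ L₂ Q Q' Q₁ Q₂ C C' C₁ C₂ : 𝔸} {s s' s₁ s₂ t : ℝ}

omit [NormedAlgebra ℂ 𝔸] [CompleteSpace 𝔸] in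
/-- The amplitude is nonnegative. [folklore] -/
theorem nonneg (h : T3 P L Q C s) : 0 ≤ s := (norm_nonneg L).trans h.norm_lin

omit [NormedAlgebra ℂ 𝔸] [CompleteSpace 𝔸] in
/-- The second-order data underneath. [folklore] -/
theorem toT2 (h : T3 P L Q C s) : T2 P L Q s :=
  ⟨h.norm_lin, h.ord0, h.ord1, h.ord2⟩

omit [NormedAlgebra ℂ 𝔸] [CompleteSpace 𝔸] in
/-- Rewriting the data. [folklore] -/
theorem congr (h : T3 P L Q C s) (hL : L = L') (hQ : Q = Q') (hC : C = C') (hs : s = s') : T3 P L' Q' C' s' := by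
  subst hL hQ hC hs
  exact h

omit [NormedAlgebra ℂ 𝔸] [CompleteSpace 𝔸] in
/-- The unit word: `1 = 1 + 0 + 0 + 0`, amplitude `0`. [folklore] -/
theorem one : T3 (1 : 𝔸) 0 0 0 0 where
  norm_lin := by simp
  norm_quad := by simp
  norm_cub := by simp
  ord0 := by simp
  ord1 := by simp [expRem]
  ord2 := by simp [expRem3]
  ord3 := by simp [expRem4]

omit [NormedAlgebra ℂ 𝔸] [CompleteSpace 𝔸] in
/-- PRODUCTS: `(1 + L₁ + Q₁ + C₁ + …)(1 + L₂ + Q₂ + C₂ + …) = 1 + (L₁ + L₂) + (Q₁ + L₁L₂ + Q₂)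
+ (C₁ + Q₁L₂ + L₁Q₂ + C₂) + …` with amplitude `s₁ + s₂` — exactly, by
`ρ₄(s₁ + s₂) = ρ₄(s₁) + ρ₄(s₂) + ρ₃(s₁)s₂ + ρ(s₁)ρ(s₂) + s₁ρ₃(s₂)` and the identity
`P₁P₂ − 1 − L − Q − C = (P₁−1−L₁−Q₁−C₁) + (P₂−1−L₂−Q₂−C₂) + (P₁−1−L₁−Q₁)L₂ + (P₁−1−L₁)(P₂−1−L₂) + L₁(P₂−1−L₂−Q₂)`.
[folklore] -/
theorem mul (h₁ : T3 P₁ L₁ Q₁ C₁ s₁) (h₂ : T3 P₂ L₂ Q₂ C₂ s₂) :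
    T3 (P₁ * P₂) (L₁ + L₂) (Q₁ + L₁ * L₂ + Q₂) (C₁ + Q₁ * L₂ + L₁ * Q₂ + C₂) (s₁ + s₂) where
  norm_lin := (h₁.toT2.mul h₂.toT2).norm_lin
  norm_quad := by
    have hs₁ := h₁.nonneg
    have hs₂ := h₂.nonneg
    calc ‖Q₁ + L₁ * L₂ + Q₂‖ ≤ ‖Q₁‖ + ‖L₁ * L₂‖ + ‖Q₂‖ := norm_add₃_le
      _ ≤ ‖Q₁‖ + ‖L₁‖ * ‖L₂‖ + ‖Q₂‖ := by gcongr; exact norm_mul_le _ _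
      _ ≤ s₁ ^ 2 / 2 + s₁ * s₂ + s₂ ^ 2 / 2 := by
        gcongr
        · exact h₁.norm_quad
        · exact h₁.norm_lin
        · exact h₂.norm_lin
        · exact h₂.norm_quad
      _ = (s₁ + s₂) ^ 2 / 2 := by ring
  norm_cub := by
    have hs₁ := h₁.nonneg
    have hs₂ := h₂.nonneg
    calc ‖C₁ + Q₁ * L₂ + L₁ * Q₂ + C₂‖ ≤ ‖C₁‖ + ‖Q₁ * L₂‖ + ‖L₁ * Q₂‖ + ‖C₂‖ := by
          refine (norm_add_le _ _).trans (add_le_add ((norm_add_le _ _).trans (add_le_add ?_ le_rfl)) le_rfl)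
          exact norm_add_le _ _
      _ ≤ ‖C₁‖ + ‖Q₁‖ * ‖L₂‖ + ‖L₁‖ * ‖Q₂‖ + ‖C₂‖ := by gcongr <;> exact norm_mul_le _ _
      _ ≤ s₁ ^ 3 / 6 + s₁ ^ 2 / 2 * s₂ + s₁ * (s₂ ^ 2 / 2) + s₂ ^ 3 / 6 := by
        gcongr
        · exact h₁.norm_cub
        · exact h₁.norm_quad
        · exact h₂.norm_lin
        · exact h₁.norm_lin
        · exact h₂.norm_quad
        · exact h₂.norm_cub
      _ = (s₁ + s₂) ^ 3 / 6 := by ring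
  ord0 := (h₁.toT2.mul h₂.toT2).ord0
  ord1 := (h₁.toT2.mul h₂.toT2).ord1
  ord2 := (h₁.toT2.mul h₂.toT2).ord2
  ord3 := by
    have heq : P₁ * P₂ - 1 - (L₁ + L₂) - (Q₁ + L₁ * L₂ + Q₂) - (C₁ + Q₁ * L₂ + L₁ * Q₂ + C₂) =
        (P₁ - 1 - L₁ - Q₁ - C₁) + (P₂ - 1 - L₂ - Q₂ - C₂) + (P₁ - 1 - L₁ - Q₁) * L₂
          + (P₁ - 1 - L₁) * (P₂ - 1 - L₂) + L₁ * (P₂ - 1 - L₂ - Q₂) := by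
      noncomm_ring
    have hs₁ := h₁.nonneg
    have hs₂ := h₂.nonneg
    rw [heq]
    calc _ ≤ ‖P₁ - 1 - L₁ - Q₁ - C₁‖ + ‖P₂ - 1 - L₂ - Q₂ - C₂‖ + ‖(P₁ - 1 - L₁ - Q₁) * L₂‖
          + ‖(P₁ - 1 - L₁) * (P₂ - 1 - L₂)‖ + ‖L₁ * (P₂ - 1 - L₂ - Q₂)‖ := by
          refine (norm_add_le _ _).trans (add_le_add ?_ le_rfl)
          refine (norm_add_le _ _).trans (add_le_add ?_ le_rfl)
          refine (norm_add_le _ _).trans (add_le_add ?_ le_rfl)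
          exact norm_add_le _ _
      _ ≤ ‖P₁ - 1 - L₁ - Q₁ - C₁‖ + ‖P₂ - 1 - L₂ - Q₂ - C₂‖ + ‖P₁ - 1 - L₁ - Q₁‖ * ‖L₂‖
          + ‖P₁ - 1 - L₁‖ * ‖P₂ - 1 - L₂‖ + ‖L₁‖ * ‖P₂ - 1 - L₂ - Q₂‖ := by
          gcongr <;> exact norm_mul_le _ _
      _ ≤ expRem4 s₁ + expRem4 s₂ + expRem3 s₁ * s₂ + expRem s₁ * expRem s₂ + s₁ * expRem3 s₂ := by
          gcongr
          all_goals first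
            | exact expRem3_nonneg hs₁
            | exact expRem_nonneg _
            | exact h₁.ord3
            | exact h₂.ord3
            | exact h₁.ord2
            | exact h₂.norm_lin
            | exact h₁.ord1
            | exact h₂.ord1
            | exact h₁.norm_lin
            | exact h₂.ord2
      _ = expRem4 (s₁ + s₂) := (expRem4_add s₁ s₂).symm

/-- THE EXPONENTIAL: `e^B = 1 + B + ½B² + ⅙B³ + O₁(ρ₄(a))` for `‖B‖ ≤ a`. [folklore] -/
theorem exp {B : 𝔸} {a : ℝ} (h : ‖B‖ ≤ a) :
    T3 (exp B) B ((2 : ℂ)⁻¹ • (B * B)) ((6 : ℂ)⁻¹ • (B * B * B)) a where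
  norm_lin := h
  norm_quad := by
    have h0 : 0 ≤ a := (norm_nonneg B).trans h
    rw [norm_smul, norm_inv, RCLike.norm_ofNat]
    calc 2⁻¹ * ‖B * B‖ ≤ 2⁻¹ * (a * a) := by
          gcongr
          exact (norm_mul_le _ _).trans (mul_le_mul h h (norm_nonneg _) h0)
      _ = a ^ 2 / 2 := by ring
  norm_cub := by
    have h0 : 0 ≤ a := (norm_nonneg B).trans h
    rw [norm_smul, norm_inv, RCLike.norm_ofNat]
    calc 6⁻¹ * ‖B * B * B‖ ≤ 6⁻¹ * (a * a * a) := by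
          gcongr
          calc ‖B * B * B‖ ≤ ‖B * B‖ * ‖B‖ := norm_mul_le _ _
            _ ≤ (‖B‖ * ‖B‖) * ‖B‖ := by gcongr; exact norm_mul_le _ _
            _ ≤ a * a * a := by gcongr
      _ = a ^ 3 / 6 := by ring
  ord0 := (T2.exp h).ord0
  ord1 := (T2.exp h).ord1
  ord2 := (T2.exp h).ord2
  ord3 := by
    have h1 : HasSum (fun n : ℕ => ((n.factorial : ℂ)⁻¹) • B ^ n) (NormedSpace.exp B) :=
      exp_series_hasSum_exp' (𝕂 := ℂ) B
    have h1' : HasSum (fun n : ℕ => (((n + 4).factorial : ℂ)⁻¹) • B ^ (n + 4))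
        (NormedSpace.exp B - 1 - B - (2 : ℂ)⁻¹ • (B * B) - (6 : ℂ)⁻¹ • (B * B * B)) := by
      have h' := (hasSum_nat_add_iff' 4).mpr h1
      have heq : ∑ i ∈ Finset.range 4, ((i.factorial : ℂ)⁻¹) • B ^ i =
          1 + B + (2 : ℂ)⁻¹ • (B * B) + (6 : ℂ)⁻¹ • (B * B * B) := by
        simp only [Finset.sum_range_succ, Finset.sum_range_zero, Nat.factorial]
        norm_num [pow_succ, mul_assoc]
      rw [heq, ← sub_sub, ← sub_sub, ← sub_sub] at h'
      exact h'
    have h2 : HasSum (fun n : ℕ => ‖B‖ ^ n / (n.factorial : ℝ)) (Real.exp ‖B‖) := by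
      rw [Real.exp_eq_exp_ℝ]
      exact expSeries_div_hasSum_exp ‖B‖
    have h2' : HasSum (fun n : ℕ => ‖B‖ ^ (n + 4) / ((n + 4).factorial : ℝ)) (expRem4 ‖B‖) := by
      have h' := (hasSum_nat_add_iff' 4).mpr h2
      have heq : ∑ i ∈ Finset.range 4, ‖B‖ ^ i / (i.factorial : ℝ) = 1 + ‖B‖ + ‖B‖ ^ 2 / 2 + ‖B‖ ^ 3 / 6 := by
        simp only [Finset.sum_range_succ, Finset.sum_range_zero, Nat.factorial]
        norm_num
      rw [heq] at h'
      have e4 : Real.exp ‖B‖ - (1 + ‖B‖ + ‖B‖ ^ 2 / 2 + ‖B‖ ^ 3 / 6) = expRem4 ‖B‖ := by unfold expRem4; ring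
      rw [e4] at h'
      exact h'
    have h3 : ‖NormedSpace.exp B - 1 - B - (2 : ℂ)⁻¹ • (B * B) - (6 : ℂ)⁻¹ • (B * B * B)‖ ≤ expRem4 ‖B‖ :=
      h1'.norm_le_of_bounded h2' fun n => by
        rw [norm_smul, norm_inv, RCLike.norm_natCast, div_eq_inv_mul]
        gcongr
        exact norm_pow_le' B (by omega)
    exact h3.trans (expRem4_mono (norm_nonneg _) h)

omit [NormedAlgebra ℂ 𝔸] [CompleteSpace 𝔸] in
/-- Monotonicity in the amplitude. [folklore] -/
theorem mono (h : T3 P L Q C s) (hst : s ≤ t) : T3 P L Q C t where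
  norm_lin := h.norm_lin.trans hst
  norm_quad := h.norm_quad.trans (by have := h.nonneg; gcongr)
  norm_cub := h.norm_cub.trans (by have := h.nonneg; gcongr)
  ord0 := h.ord0.trans (exp_sub_one_mono hst)
  ord1 := h.ord1.trans (expRem_mono h.nonneg hst)
  ord2 := h.ord2.trans (expRem3_mono h.nonneg hst)
  ord3 := h.ord3.trans (expRem4_mono h.nonneg hst)

end T3

end Taylor

/-! ## §2 Words of exponentials and their explicit polynomials to the third order -/

section Words

variable {𝔸 : Type*} [NormedRing 𝔸] [NormedAlgebra ℂ 𝔸] [CompleteSpace 𝔸]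

/-- `e^{y₁}e^{y₂}⋯e^{yₙ}`. [folklore] -/
def expProd (ys : List 𝔸) : 𝔸 := (ys.map exp).prod

/-- The linear part `Σ yᵢ` of the word. [folklore] -/
def polyL : List 𝔸 → 𝔸
  | [] => 0
  | y :: ys => y + polyL ys

/-- The quadratic part `Σ ½yᵢ² + Σ_{i<j} yᵢyⱼ` of the word (nested form). [folklore] -/
def polyQ : List 𝔸 → 𝔸
  | [] => 0
  | y :: ys => (2 : ℂ)⁻¹ • (y * y) + y * polyL ys + polyQ ys

/-- The cubic part `Σ ⅙yᵢ³ + Σ_{i<j} ½(yᵢ²yⱼ + yᵢyⱼ²) + Σ_{i<j<k} yᵢyⱼyₖ` of the word (nested form). [folklore] -/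
def polyC : List 𝔸 → 𝔸
  | [] => 0
  | y :: ys => (6 : ℂ)⁻¹ • (y * y * y) + (2 : ℂ)⁻¹ • (y * y) * polyL ys + y * polyQ ys + polyC ys

omit [NormedAlgebra ℂ 𝔸] [CompleteSpace 𝔸] in
/-- [folklore] -/
@[simp] theorem polyL_nil : polyL ([] : List 𝔸) = 0 := rfl

omit [NormedAlgebra ℂ 𝔸] [CompleteSpace 𝔸] in
/-- [folklore] -/
@[simp] theorem polyL_cons (y : 𝔸) (ys : List 𝔸) : polyL (y :: ys) = y + polyL ys := rfl

omit [CompleteSpace 𝔸] in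
/-- [folklore] -/
@[simp] theorem polyQ_nil : polyQ ([] : List 𝔸) = 0 := rfl

omit [CompleteSpace 𝔸] in
/-- [folklore] -/
@[simp] theorem polyQ_cons (y : 𝔸) (ys : List 𝔸) :
    polyQ (y :: ys) = (2 : ℂ)⁻¹ • (y * y) + y * polyL ys + polyQ ys := rfl

omit [CompleteSpace 𝔸] in
/-- [folklore] -/
@[simp] theorem polyC_nil : polyC ([] : List 𝔸) = 0 := rfl

omit [CompleteSpace 𝔸] in
/-- [folklore] -/
@[simp] theorem polyC_cons (y : 𝔸) (ys : List 𝔸) :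
    polyC (y :: ys) = (6 : ℂ)⁻¹ • (y * y * y) + (2 : ℂ)⁻¹ • (y * y) * polyL ys + y * polyQ ys + polyC ys := rfl

omit [NormedAlgebra ℂ 𝔸] [CompleteSpace 𝔸] in
/-- [folklore] -/
@[simp] theorem expProd_nil : expProd ([] : List 𝔸) = 1 := by simp [expProd]

omit [NormedAlgebra ℂ 𝔸] [CompleteSpace 𝔸] in
/-- [folklore] -/
@[simp] theorem expProd_cons (y : 𝔸) (ys : List 𝔸) : expProd (y :: ys) = exp y * expProd ys := by
  simp [expProd]

/-- **THE WORD CARRIES THIRD-ORDER DATA**: `e^{y₁}⋯e^{yₙ} = 1 + polyL + polyQ + polyC + O₁(ρ₄(Σ‖yᵢ‖))`, every order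
controlled by the real exponential series at the amplitude `Σ‖yᵢ‖`. [folklore] -/
theorem t3_expProd : ∀ ys : List 𝔸, T3 (expProd ys) (polyL ys) (polyQ ys) (polyC ys) (ys.map (‖·‖)).sum
  | [] => by simpa using (T3.one (𝔸 := 𝔸))
  | y :: ys => by
    have h := (T3.exp (le_refl ‖y‖)).mul (t3_expProd ys)
    simp only [expProd_cons, polyL_cons, polyQ_cons, polyC_cons, List.map_cons, List.sum_cons]
    refine h.congr rfl rfl ?_ rfl
    simp only [smul_mul_assoc]

/-- … hence with any amplitude `s ≥ Σ‖yᵢ‖`. [folklore] -/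
theorem t3_expProd_of_le {ys : List 𝔸} {s : ℝ} (hs : (ys.map (‖·‖)).sum ≤ s) :
    T3 (expProd ys) (polyL ys) (polyQ ys) (polyC ys) s :=
  (t3_expProd ys).mono hs

omit [CompleteSpace 𝔸] in
/-- Homogeneity: `polyL (t•ys) = t • polyL ys`. [folklore] -/
theorem polyL_smul (t : ℂ) : ∀ ys : List 𝔸, polyL (ys.map (t • ·)) = t • polyL ys
  | [] => by simp
  | y :: ys => by simp [polyL_smul t ys, smul_add]

omit [CompleteSpace 𝔸] in
/-- Homogeneity: `polyQ (t•ys) = t² • polyQ ys`. [folklore] -/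
theorem polyQ_smul (t : ℂ) : ∀ ys : List 𝔸, polyQ (ys.map (t • ·)) = t ^ 2 • polyQ ys
  | [] => by simp
  | y :: ys => by
    simp only [List.map_cons, polyQ_cons, polyL_smul t ys, polyQ_smul t ys, smul_mul_assoc, mul_smul_comm, smul_smul,
      smul_add]
    module

omit [CompleteSpace 𝔸] in
/-- Homogeneity: `polyC (t•ys) = t³ • polyC ys`. [folklore] -/
theorem polyC_smul (t : ℂ) : ∀ ys : List 𝔸, polyC (ys.map (t • ·)) = t ^ 3 • polyC ys
  | [] => by simp
  | y :: ys => by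
    simp only [List.map_cons, polyC_cons, polyL_smul t ys, polyQ_smul t ys, polyC_smul t ys, smul_mul_assoc,
      mul_smul_comm, smul_smul, smul_add]
    module

omit [CompleteSpace 𝔸] in
/-- The amplitude of the scaled word. [folklore] -/
theorem sum_norm_smul (t : ℂ) (ys : List 𝔸) : ((ys.map (t • ·)).map (‖·‖)).sum = ‖t‖ * (ys.map (‖·‖)).sum := by
  induction ys with
  | nil => simp
  | cons y ys ih =>
    simp only [List.map_cons, List.sum_cons, norm_smul, List.map_map] at ih ⊢
    rw [ih, mul_add]

end Words

end Summit.QuantumFields.BalabanUV.T4Continuum.ShellMeasureCubicTaylor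

end
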